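import Literature.Geometry.Symplectic.JPlanePencilLocalFamilyProofs
import HarnessLib

/-!
# Pencil members of different intercepts meet only in a compact set

Third file of the cluster `JPlanePencilLocalFamily.lean` (the named fact
`Literature.Geometry.Symplectic.jPlanePencil_localFamily_homotopySphere`, Wendl LNM 2216 Prop. 2.53
with `m = 1`, NOT discharged) / `JPlanePencilLocalFamilyProofs.lean` (proved plane↔sphere
dictionary: graph normal form near infinity, far vertical lines meet a member once). Here: the
finiteness-of-support input of every intersection count between two pencil members
(Wendl 2018, Thm 2.49 as used on p. 66 for the curves of `𝒰`; in the end-compactification two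
members of different intercepts are embedded spheres through `q_a` with DIFFERENT tangents there,
so all their other intersections lie in a compact part of `M ∖ p`):

* `IsPencilPlane.exists_norm_lt_of_apply_eq`, `IsPencilPlane.exists_norm_lt_and_of_apply_eq` — if
  `u₁ ξ₁ = u₂ ξ₂` for members of intercepts `b₁ ≠ b₂` then `‖ξ₁‖, ‖ξ₂‖ < R`: far out `u₁` has
  `w ≈ b₁` and large `z`, so the common point has large `z`, which forces `ξ₂` far out as well
  (`z ∘ u₂` is bounded on compact parameter sets within the chart domain,
  `IsPencilPlane.exists_norm_fst_le_of_isCompact`), where `w ≈ b₂` — impossible;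
* `IsPencilPlane.isCompact_setOf_apply_eq` — the set `{(ξ₁, ξ₂) | u₁ ξ₁ = u₂ ξ₂}` is compact.

Everything is PROVED; no definition and no named fact is introduced.

## References

* C. Wendl, *Holomorphic Curves in Low Dimensions*, Lecture Notes in Math. 2216, Springer (2018),
  Thm 2.49 and the proof of Prop. 2.53, p. 66. [Wendl2018]
* M. Gromov, *Pseudo holomorphic curves in symplectic manifolds*, Invent. Math. 82 (1985),
  2.4.A′. [Gromov1985]
-/

noncomputable section

open scoped Manifold ContDiff Topology
open Set Filter

namespace Literature.Geometry.Symplectic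

variable {M : Type*} [TopologicalSpace M] [T2Space M] [ChartedSpace (EuclideanSpace ℝ (Fin 4)) M]
  [CompactSpace M] {p : M}
  {J : ∀ x : punctured p, TangentSpace (𝓡 4) x →L[ℝ] TangentSpace (𝓡 4) x}

namespace IsPencilPlane

/-- One-sided form: if `u₁ ξ₁ = u₂ ξ₂` for members of DIFFERENT intercepts `b₁ ≠ b₂`, then `ξ₁`
is bounded — far out, `u₁` has `w ≈ b₁` and large `z`, so the common point has large `z`, which
forces `ξ₂` far out as well (`z ∘ u₂` is bounded on compact parameter sets within the chart
domain), where `w ≈ b₂`: impossible. [folklore] -/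
theorem exists_norm_lt_of_apply_eq {u₁ u₂ : ℂ → punctured p} {b₁ b₂ : ℂ}
    (h₁ : IsPencilPlane J u₁ b₁) (h₂ : IsPencilPlane J u₂ b₂) (hb : b₁ ≠ b₂) :
    ∃ R : ℝ, ∀ ξ₁ ξ₂ : ℂ, u₁ ξ₁ = u₂ ξ₂ → ‖ξ₁‖ < R := by
  have hδ : 0 < ‖b₁ - b₂‖ / 3 := by
    have : 0 < ‖b₁ - b₂‖ := norm_pos_iff.2 (sub_ne_zero.2 hb)
    linarith
  -- far out, `w(u₂ ξ) ≈ b₂`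
  have e2 : ∀ᶠ ξ in cocompact ℂ, ‖(pencilCoord p (u₂ ξ)).2 - b₂‖ < ‖b₁ - b₂‖ / 3 := by
    have := (Metric.tendsto_nhds.1 h₂.tendsto_snd) _ hδ
    simpa [dist_eq_norm] using this
  obtain ⟨R₂, hR₂⟩ := exists_forall_norm_le_of_eventually_cocompact e2
  -- `z ∘ u₂` is bounded on the disc `‖ξ‖ ≤ R₂` (within the chart domain)
  obtain ⟨C, hC⟩ := h₂.exists_norm_fst_le_of_isCompact (isCompact_closedBall (0 : ℂ) R₂)
  -- far out, `w(u₁ ξ) ≈ b₁`, `‖z(u₁ ξ)‖ > C`, and `u₁ ξ` is in the chart ball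
  have e1 : ∀ᶠ ξ in cocompact ℂ, ‖(pencilCoord p (u₁ ξ)).2 - b₁‖ < ‖b₁ - b₂‖ / 3 ∧
      C < ‖(pencilCoord p (u₁ ξ)).1‖ ∧ InPuncturedChartBall p 1 (u₁ ξ) := by
    have a1 : ∀ᶠ ξ in cocompact ℂ, ‖(pencilCoord p (u₁ ξ)).2 - b₁‖ < ‖b₁ - b₂‖ / 3 := by
      have := (Metric.tendsto_nhds.1 h₁.tendsto_snd) _ hδ
      simpa [dist_eq_norm] using this
    exact (a1.and (h₁.tendsto_norm_fst.eventually_gt_atTop C)).and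
      (h₁.eventually_inPuncturedChartBall one_pos) |>.mono fun ξ hξ => ⟨hξ.1.1, hξ.1.2, hξ.2⟩
  obtain ⟨R₁, hR₁⟩ := exists_forall_norm_le_of_eventually_cocompact e1
  refine ⟨R₁, fun ξ₁ ξ₂ heq => ?_⟩
  by_contra hge
  rw [not_lt] at hge
  obtain ⟨hw₁, hz₁, hball₁⟩ := hR₁ ξ₁ hge
  -- the common point has large `z`, so `ξ₂` is far out
  have hsrc₂ : (u₂ ξ₂).1 ∈ (chartAt (EuclideanSpace ℝ (Fin 4)) p).source := by
    rw [← heq]; exact hball₁.1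
  have hfar₂ : R₂ ≤ ‖ξ₂‖ := by
    by_contra hlt
    rw [not_le] at hlt
    have hmem : ξ₂ ∈ Metric.closedBall (0 : ℂ) R₂ := by
      rw [Metric.mem_closedBall, dist_zero_right]; exact hlt.le
    have := hC ξ₂ hmem hsrc₂
    rw [← heq] at this
    linarith
  have hw₂ := hR₂ ξ₂ hfar₂
  rw [← heq] at hw₂
  -- `b₁` and `b₂` are both within `‖b₁ - b₂‖ / 3` of the same `w`
  have : ‖b₁ - b₂‖ ≤ ‖(pencilCoord p (u₁ ξ₁)).2 - b₁‖ + ‖(pencilCoord p (u₁ ξ₁)).2 - b₂‖ := by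
    calc ‖b₁ - b₂‖ = ‖((pencilCoord p (u₁ ξ₁)).2 - b₂) - ((pencilCoord p (u₁ ξ₁)).2 - b₁)‖ := by
          congr 1; ring
      _ ≤ ‖(pencilCoord p (u₁ ξ₁)).2 - b₂‖ + ‖(pencilCoord p (u₁ ξ₁)).2 - b₁‖ := norm_sub_le _ _
      _ = _ := add_comm _ _
  linarith

/-- **Members of different intercepts meet only in a compact set**: all solutions `(ξ₁, ξ₂)` of
`u₁ ξ₁ = u₂ ξ₂` lie in a bounded set (the members are disjoint near infinity, where they are
graphs `w = H₁(z) → b₁`, `w = H₂(z) → b₂` with `b₁ ≠ b₂`). This is the finiteness-of-support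
input of every intersection count between members (Wendl 2018, Thm 2.49, as used on p. 66 for
the curves of `𝒰`). [cite: Wendl2018, Thm 2.49] -/
theorem exists_norm_lt_and_of_apply_eq {u₁ u₂ : ℂ → punctured p} {b₁ b₂ : ℂ}
    (h₁ : IsPencilPlane J u₁ b₁) (h₂ : IsPencilPlane J u₂ b₂) (hb : b₁ ≠ b₂) :
    ∃ R : ℝ, ∀ ξ₁ ξ₂ : ℂ, u₁ ξ₁ = u₂ ξ₂ → ‖ξ₁‖ < R ∧ ‖ξ₂‖ < R := by
  obtain ⟨R₁, hR₁⟩ := exists_norm_lt_of_apply_eq h₁ h₂ hb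
  obtain ⟨R₂, hR₂⟩ := exists_norm_lt_of_apply_eq h₂ h₁ hb.symm
  refine ⟨max R₁ R₂, fun ξ₁ ξ₂ heq => ⟨?_, ?_⟩⟩
  · exact lt_of_lt_of_le (hR₁ ξ₁ ξ₂ heq) (le_max_left _ _)
  · exact lt_of_lt_of_le (hR₂ ξ₂ ξ₁ heq.symm) (le_max_right _ _)

/-- Hence the set of intersection parameters of two members of different intercepts is compact
(closed, by continuity, and bounded). [cite: Wendl2018, Thm 2.49] -/
theorem isCompact_setOf_apply_eq {u₁ u₂ : ℂ → punctured p} {b₁ b₂ : ℂ}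
    (h₁ : IsPencilPlane J u₁ b₁) (h₂ : IsPencilPlane J u₂ b₂) (hb : b₁ ≠ b₂) :
    IsCompact {q : ℂ × ℂ | u₁ q.1 = u₂ q.2} := by
  obtain ⟨R, hR⟩ := exists_norm_lt_and_of_apply_eq h₁ h₂ hb
  have hclosed : IsClosed {q : ℂ × ℂ | u₁ q.1 = u₂ q.2} :=
    isClosed_eq (h₁.continuous.comp continuous_fst) (h₂.continuous.comp continuous_snd)
  refine Metric.isCompact_of_isClosed_isBounded hclosed ?_
  refine (Metric.isBounded_closedBall (x := (0 : ℂ × ℂ)) (r := R)).subset fun q hq => ?_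
  obtain ⟨h1, h2⟩ := hR q.1 q.2 hq
  rw [Metric.mem_closedBall, dist_zero_right, Prod.norm_def]
  exact max_le h1.le h2.le

end IsPencilPlane

end Literature.Geometry.Symplectic
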